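import Summits.QuantumFields.YangMills.Theorems.FradkinShenkerFlowPoincareToClusteringCovariance

/-!
# `PoincareToClustering`: the uniform heat-bath Poincaré inequality implies exponential clustering

Route `FradkinShenkerFlow` of `YangMills`, support item `stmt-QuantumFields-9444`: this file
proves the route decl
`Summit.QuantumFields.YangMills.Theses.FradkinShenkerFlow.PoincareToClustering` (UP ⇒ EC):
for every compact group `G` with a lattice representation `r` and every `β ≥ 0`, if the torus
Wilson measures `μ_{β,S}` on `(ℤ/(2S+1))⁴` satisfy the single-link heat-bath Poincaré inequality
with a constant `C` uniform in `S`, then there is `m = m(C) > 0` such that for all bounded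
gauge-invariant local observables `A, B` there is `C(A,B)` with
`|⟨A · τ_{n e₀} B⟩_{β,S} − ⟨A⟩⟨B⟩| ≤ C(A,B) e^{−m n}` for all `S` and `n ≤ S`.

## Proof

Apply the one-torus covariance bound `abs_cov_le` (file `…Covariance`: spectral gap of the
discrete-time random-scan heat bath from UP, `…Gap`, and its β-independent finite speed of
propagation in oscillation form, `…Propagation`) to `f = A ∘ lift` and `g = B ∘ τ_{n e₀} ∘ lift`
with Glauber time `k = ⌊n / K₀⌋`, `K₀ = 1200 ≥ 400 e`, weight `a = e^{-1}` and centre the time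
slice `n`: the links read by `g` have cyclic time distance `≤ R_B` from the slice `n`, those read
by `f` have distance `≥ n − R_A` (this is where `n ≤ S` enters: `2n < 2S+1`), so the two terms of
`abs_cov_le` are `≤ 4 M_A M_B e^{−n/(4 C' K₀)}` and `≤ 8 |supp A| M_A M_B e^{R_A+R_B} e^{−n/4}`,
`C' = max C 1`; hence `m = 1/(4 C' K₀)` and `C(A,B) = 4 M_A M_B + 8 |supp A| M_A M_B e^{R_A+R_B}`.

References: F. Martinelli, LNM 1717 (1999), §3–4; T. Liggett, *Interacting Particle Systems*
(2005), Ch. I; the card's sources Martinelli1999, Liggett2005.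
-/

noncomputable section

open MeasureTheory ProbabilityTheory
open Literature.MathematicalPhysics.QuantumFieldTheory Literature.MathematicalPhysics.QuantumLattice

namespace Summit.QuantumFields.YangMills.Theorems.PoincareClustering

/-! ### Lifted local observables on the torus -/

section Observables

variable {G : Type} [Group G] [MeasurableSpace G] {L : ℕ}

/-- `A ∘ lift` does not read the torus links outside the image of `supp A`. [folklore] -/
theorem apply_torusLift_update (A : YMSpecies G) {ℓ : Edge 4 L}
    (hℓ : ℓ ∉ A.supp.image (torusEdge L)) (U : GaugeConfig 4 L G) (g : G) :
    A.F (torusLift L (Function.update U ℓ g)) = A.F (torusLift L U) := by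
  refine A.isCylinder (fun e he => ?_)
  show Function.update U ℓ g (torusEdge L e) = U (torusEdge L e)
  exact Function.update_of_ne (fun h => hℓ (Finset.mem_image.2 ⟨e, he, h⟩)) _ _

/-- `B ∘ τ ∘ lift` does not read the torus links outside the image of the translated support.
[folklore] -/
theorem apply_configShift_torusLift_update (B : YMSpecies G)
    (v : Literature.Probability.LatticeModels.Site 4) {ℓ : Edge 4 L}
    (hℓ : ℓ ∉ B.supp.image (fun e => torusEdge L (e.1 - v, e.2))) (U : GaugeConfig 4 L G)
    (g : G) :
    B.F (configShift v (torusLift L (Function.update U ℓ g))) =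
      B.F (configShift v (torusLift L U)) := by
  refine B.isCylinder (fun e he => ?_)
  rw [configShift_apply, configShift_apply]
  show Function.update U ℓ g (torusEdge L (e.1 - v, e.2)) = U (torusEdge L (e.1 - v, e.2))
  exact Function.update_of_ne (fun h => hℓ (Finset.mem_image.2 ⟨e, he, h⟩)) _ _

/-- The oscillations of a lifted bounded observable vanish off the image of its support and
are at most `2M` on it. [folklore] -/
theorem osc_configShift_torusLift_le (B : YMSpecies G)
    (v : Literature.Probability.LatticeModels.Site 4) {M : ℝ} (hM : ∀ V, |B.F V| ≤ M)
    (ℓ : Edge 4 L) :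
    osc (fun U : GaugeConfig 4 L G => B.F (configShift v (torusLift L U))) ℓ ≤
      if ℓ ∈ B.supp.image (fun e => torusEdge L (e.1 - v, e.2)) then M + M else 0 := by
  refine osc_le fun U g => ?_
  split_ifs with h
  · exact (abs_sub _ _).trans (add_le_add (hM _) (hM _))
  · rw [apply_configShift_torusLift_update B v h, sub_self, abs_zero]

end Observables

/-! ### Time distances of the supports on the torus of side `2S+1` -/

section TimeDistance

/-- **The separation lemma**: for `n ≤ S`, `|z| ≤ R`, the cyclic distance of `z − n` from `0`
around `ℤ/(2S+1)` is at least `n − R` (since `2n < 2S+1`, no wrap-around can make the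
time-`z` support of `A` closer to the slice `n`). [folklore] -/
theorem sub_le_natAbs_valMinAbs (S n R : ℕ) (hn : n ≤ S) (z : ℤ) (hz : z.natAbs ≤ R) :
    n - R ≤ (((z - n : ℤ) : ZMod (2 * S + 1)).valMinAbs).natAbs := by
  set v := (((z - n : ℤ) : ZMod (2 * S + 1)).valMinAbs) with hv
  have hdvd : ((2 * S + 1 : ℕ) : ℤ) ∣ v - (z - n) :=
    (ZMod.intCast_eq_intCast_iff_dvd_sub (z - n) v (2 * S + 1)).1 (by rw [hv, ZMod.coe_valMinAbs])
  by_contra hcon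
  rw [not_le] at hcon
  have hlt : (v - (z - n)).natAbs < ((2 * S + 1 : ℕ) : ℤ).natAbs := by omega
  have h0 := Int.eq_zero_of_dvd_of_natAbs_lt_natAbs hdvd hlt
  omega

variable {G : Type} [Group G] [MeasurableSpace G] {S : ℕ}

/-- Links read by `B ∘ τ_{n e₀} ∘ lift` are within cyclic time distance `R_B` of the slice `n`,
`R_B = max_{e ∈ supp B} |e.1 0|`. [folklore] -/
theorem tdist_le_of_mem_image_shift (B : YMSpecies G) (n : ℕ) {ℓ : Edge 4 (2 * S + 1)}
    (hℓ : ℓ ∈ B.supp.image (fun e => torusEdge (2 * S + 1)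
      (e.1 - -Pi.single (0 : Fin 4) (n : ℤ), e.2))) :
    tdist (n : ZMod (2 * S + 1)) ℓ ≤ B.supp.sup (fun e => (e.1 0).natAbs) := by
  obtain ⟨e, he, rfl⟩ := Finset.mem_image.1 hℓ
  refine le_trans ?_ (Finset.le_sup (f := fun e => (e.1 0).natAbs) he)
  unfold tdist torusEdge Literature.Probability.LatticeModels.Torus.proj
  simp only [Pi.sub_apply, Pi.neg_apply, Pi.single_eq_same, sub_neg_eq_add, Int.cast_add,
    Int.cast_natCast, add_sub_cancel_right]
  exact natAbs_valMinAbs_intCast_le _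

/-- Links read by `A ∘ lift` are at cyclic time distance at least `n − R_A` from the slice `n`
when `n ≤ S`, `R_A = max_{e ∈ supp A} |e.1 0|`. [folklore] -/
theorem sub_le_tdist_of_mem_image (A : YMSpecies G) {n : ℕ} (hn : n ≤ S)
    {ℓ : Edge 4 (2 * S + 1)} (hℓ : ℓ ∈ A.supp.image (torusEdge (2 * S + 1))) :
    n - A.supp.sup (fun e => (e.1 0).natAbs) ≤ tdist (n : ZMod (2 * S + 1)) ℓ := by
  obtain ⟨e, he, rfl⟩ := Finset.mem_image.1 hℓ
  have hz : (e.1 0).natAbs ≤ A.supp.sup (fun e => (e.1 0).natAbs) :=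
    Finset.le_sup (f := fun e => (e.1 0).natAbs) he
  unfold tdist torusEdge Literature.Probability.LatticeModels.Torus.proj
  simp only
  rw [show ((e.1 0 : ℤ) : ZMod (2 * S + 1)) - (n : ZMod (2 * S + 1)) =
    ((e.1 0 - n : ℤ) : ZMod (2 * S + 1)) by push_cast; ring]
  exact sub_le_natAbs_valMinAbs S n _ hn _ hz

end TimeDistance

/-! ### Elementary real analysis for the choice of the Glauber time -/

section Arithmetic

/-- `n ≤ 4 e^{n/4}`. [folklore] -/
theorem nat_le_four_mul_exp (n : ℕ) : (n : ℝ) ≤ 4 * Real.exp (n / 4) := by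
  have := Real.add_one_le_exp ((n : ℝ) / 4)
  nlinarith [Real.exp_pos ((n : ℝ) / 4)]

/-- `e^{1/4} ≤ 2`. [folklore] -/
theorem exp_quarter_le_two : Real.exp (1 / 4 : ℝ) ≤ 2 := by
  have h4 : Real.exp (1 / 4 : ℝ) ^ 4 = Real.exp 1 := by
    rw [← Real.exp_nat_mul]
    norm_num
  have hlt : Real.exp (1 / 4 : ℝ) ^ 4 < 2 ^ 4 := by
    rw [h4]
    have := Real.exp_one_lt_d9
    norm_num at this ⊢
    linarith
  exact (lt_of_pow_lt_pow_left₀ 4 (by norm_num) hlt).le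

/-- The Glauber time `k = ⌊n/1200⌋` as a real number. [folklore] -/
theorem cast_div_bounds (n : ℕ) :
    ((n / 1200 : ℕ) : ℝ) ≤ n / 1200 ∧ (n : ℝ) / 1200 - 1 ≤ ((n / 1200 : ℕ) : ℝ) := by
  constructor
  · rw [le_div_iff₀ (by norm_num : (0 : ℝ) < 1200)]
    exact_mod_cast Nat.div_mul_le_self n 1200
  · rw [sub_le_iff_le_add, div_le_iff₀ (by norm_num : (0 : ℝ) < 1200)]
    have h := Nat.lt_div_mul_add (a := n) (b := 1200) (by norm_num)
    have : (n : ℝ) < ((n / 1200 : ℕ) : ℝ) * 1200 + 1200 := by exact_mod_cast h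
    linarith

/-- **The gap term**: `e^{−k/(4C')} ≤ 2 e^{−n/(4·1200·C')}` for `k = ⌊n/1200⌋`, `C' ≥ 1`.
[folklore] -/
theorem gapTerm_le {C' : ℝ} (hC' : 1 ≤ C') (n : ℕ) :
    Real.exp (-(((n / 1200 : ℕ) : ℝ) / (4 * C'))) ≤
      2 * Real.exp (-(1 / (4 * C' * 1200) * n)) := by
  have hC0 : 0 < C' := by linarith
  obtain ⟨_, hk2⟩ := cast_div_bounds n
  have hu : (0 : ℝ) < (4 * C')⁻¹ := by positivity
  have hle : -(((n / 1200 : ℕ) : ℝ) / (4 * C')) ≤ 1 / (4 * C') + -(1 / (4 * C' * 1200) * n) := by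
    have e1 : ((n / 1200 : ℕ) : ℝ) / (4 * C') = ((n / 1200 : ℕ) : ℝ) * (4 * C')⁻¹ :=
      div_eq_mul_inv _ _
    have e2 : (1 : ℝ) / (4 * C') = (4 * C')⁻¹ := one_div _
    have e3 : (1 : ℝ) / (4 * C' * 1200) = (4 * C')⁻¹ / 1200 := by
      field_simp
    rw [e1, e2, e3]
    have h := mul_le_mul_of_nonneg_left hk2 hu.le
    linarith
  have h14 : Real.exp (1 / (4 * C')) ≤ 2 := by
    have : 1 / (4 * C') ≤ (1 : ℝ) / 4 :=
      div_le_div_of_nonneg_left (by norm_num) (by norm_num) (by linarith)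
    exact (Real.exp_le_exp.2 this).trans exp_quarter_le_two
  calc Real.exp (-(((n / 1200 : ℕ) : ℝ) / (4 * C')))
      ≤ Real.exp (1 / (4 * C') + -(1 / (4 * C' * 1200) * n)) := Real.exp_le_exp.2 hle
    _ = Real.exp (1 / (4 * C')) * Real.exp (-(1 / (4 * C' * 1200) * n)) := Real.exp_add _ _
    _ ≤ _ := mul_le_mul_of_nonneg_right h14 (Real.exp_pos _).le

/-- **The light-cone term**: with `k = ⌊n/1200⌋` and `D = 100`,
`k e^{2Dek} e^{−(n − R)} ≤ 4 e^{R} e^{−n/(4·1200·C')}` (`200 e k ≤ n/2`, `k ≤ n ≤ 4e^{n/4}`).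
[folklore] -/
theorem coneTerm_le {C' : ℝ} (hC' : 1 ≤ C') (n R : ℕ) :
    ((n / 1200 : ℕ) : ℝ) * (Real.exp (2 * ((4 + 1) * (4 + 4 * 4) : ℕ) / Real.exp (-1) *
      ((n / 1200 : ℕ) : ℝ)) * Real.exp (-1) ^ (n - R)) ≤
      4 * Real.exp R * Real.exp (-(1 / (4 * C' * 1200) * n)) := by
  have hC0 : 0 < C' := by linarith
  obtain ⟨hk1, _⟩ := cast_div_bounds n
  have hk0 : (0 : ℝ) ≤ ((n / 1200 : ℕ) : ℝ) := Nat.cast_nonneg _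
  have hkn : ((n / 1200 : ℕ) : ℝ) ≤ n := by
    have : (n : ℝ) / 1200 ≤ n := div_le_self (Nat.cast_nonneg _) (by norm_num)
    linarith
  have he3 : Real.exp 1 ≤ 3 := by
    have := Real.exp_one_lt_d9
    norm_num at this ⊢
    linarith
  have hexp1 : 2 * ((4 + 1) * (4 + 4 * 4) : ℕ) / Real.exp (-1) * ((n / 1200 : ℕ) : ℝ) ≤ n / 2 := by
    rw [Real.exp_neg, div_inv_eq_mul]
    have h := mul_le_mul_of_nonneg_right he3 hk0
    push_cast
    nlinarith
  have hnR : (n : ℝ) - R ≤ ((n - R : ℕ) : ℝ) := by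
    rcases le_or_gt R n with h | h
    · rw [Nat.cast_sub h]
    · rw [Nat.sub_eq_zero_of_le h.le]
      have : (n : ℝ) < R := by exact_mod_cast h
      push_cast
      linarith
  have hm : (1 : ℝ) / (4 * C' * 1200) * n ≤ n / 4 := by
    rw [div_mul_eq_mul_div, one_mul, div_le_div_iff₀ (by positivity) (by norm_num)]
    have : (n : ℝ) * 4 ≤ n * (4 * C' * 1200) :=
      mul_le_mul_of_nonneg_left (by nlinarith) (Nat.cast_nonneg _)
    linarith
  have hpow : Real.exp (-1) ^ (n - R) = Real.exp (-((n - R : ℕ) : ℝ)) := by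
    rw [← Real.exp_nat_mul]
    congr 1
    ring
  have hprod : Real.exp ((n : ℝ) / 4) * Real.exp (R - n / 2) = Real.exp R * Real.exp (-((n : ℝ) / 4)) := by
    rw [← Real.exp_add, ← Real.exp_add]
    congr 1
    ring
  rw [hpow, ← Real.exp_add]
  calc ((n / 1200 : ℕ) : ℝ) * Real.exp (2 * ((4 + 1) * (4 + 4 * 4) : ℕ) / Real.exp (-1) *
        ((n / 1200 : ℕ) : ℝ) + -((n - R : ℕ) : ℝ))
      ≤ (4 * Real.exp ((n : ℝ) / 4)) * Real.exp (R - n / 2) :=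
        mul_le_mul (hkn.trans (nat_le_four_mul_exp n)) (Real.exp_le_exp.2 (by linarith))
          (Real.exp_pos _).le (by positivity)
    _ = 4 * (Real.exp ((n : ℝ) / 4) * Real.exp (R - n / 2)) := by ring
    _ = 4 * (Real.exp R * Real.exp (-((n : ℝ) / 4))) := by rw [hprod]
    _ = 4 * Real.exp R * Real.exp (-((n : ℝ) / 4)) := by ring
    _ ≤ 4 * Real.exp R * Real.exp (-(1 / (4 * C' * 1200) * n)) := by
        refine mul_le_mul_of_nonneg_left (Real.exp_le_exp.2 ?_) (by positivity)
        linarith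

end Arithmetic

end Summit.QuantumFields.YangMills.Theorems.PoincareClustering

/-! ### The route decl -/

namespace Summit.QuantumFields.YangMills.Theorems

open PoincareClustering

/-- **UP ⇒ EC for lattice gauge theories** (route `FradkinShenkerFlow`, item
`stmt-QuantumFields-9444`, decl `PoincareToClustering`): for every compact group `G`, lattice
representation `r` and `β ≥ 0`, a single-link heat-bath Poincaré inequality for the torus Wilson
measures with a constant uniform in the volume implies exponential clustering of connected
time-correlations of all bounded gauge-invariant local observables, uniformly in the volume, for
time separations `n ≤ S`. Proof: spectral gap of the discrete-time random-scan heat bath plus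
its β-independent finite speed of propagation (`PoincareClustering.abs_cov_le`), with Glauber
time `⌊n/1200⌋`. (Martinelli 1999 §3–4; Liggett 2005 Ch. I.) [folklore] -/
theorem poincareToClustering_proof :
    Summit.QuantumFields.YangMills.Theses.FradkinShenkerFlow.PoincareToClustering := by
  intro G _ _ _ _ _ _ r β _hβ hUP
  obtain ⟨C, hC⟩ := hUP
  haveI : SecondCountableTopology G :=
    (r.continuous.isClosedEmbedding r.injective).isEmbedding.secondCountableTopology
  have hC'1 : (1 : ℝ) ≤ max C 1 := le_max_right _ _
  have hC'0 : (0 : ℝ) < max C 1 := by positivity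
  refine ⟨1 / (4 * max C 1 * 1200), by positivity, fun A B => ?_⟩
  obtain ⟨MA, hMA⟩ := A.bounded
  obtain ⟨MB, hMB⟩ := B.bounded
  have hMA0 : 0 ≤ MA := (abs_nonneg _).trans (hMA 1)
  have hMB0 : 0 ≤ MB := (abs_nonneg _).trans (hMB 1)
  refine ⟨4 * MA * MB + 8 * A.supp.card * MA * MB *
    Real.exp (((A.supp.sup fun e => (e.1 0).natAbs : ℕ) : ℝ) + ((B.supp.sup fun e => (e.1 0).natAbs : ℕ) : ℝ)),
    fun S n hn => ?_⟩
  -- the Poincaré inequality on the torus of side `2S+1`, constant `max C 1`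
  have hP : ∀ F : GaugeConfig 4 (2 * S + 1) G → ℝ, Measurable F → (∃ M : ℝ, ∀ U, |F U| ≤ M) →
      variance F (wilsonMeasure (d := 4) (L := 2 * S + 1) r.ρ β) ≤
        max C 1 * ∑ ℓ : Edge 4 (2 * S + 1), ∫ U, ∫ g, (F U - F (Function.update U ℓ g)) ^ 2
          ∂(hbLaw r.ρ β ℓ U) ∂(wilsonMeasure (d := 4) (L := 2 * S + 1) r.ρ β) := by
    intro F hF hb
    refine (hC S F hF hb).trans (mul_le_mul_of_nonneg_right (le_max_left _ _) ?_)
    exact Finset.sum_nonneg fun ℓ _ => integral_nonneg fun U => integral_nonneg fun g => sq_nonneg _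
  -- the two observables on the torus
  have hfm : Measurable fun U : GaugeConfig 4 (2 * S + 1) G => A.F (torusLift (2 * S + 1) U) :=
    A.measurable.comp (measurable_torusLift _)
  have hgm : Measurable fun U : GaugeConfig 4 (2 * S + 1) G =>
      B.F (configShift (-Pi.single (0 : Fin 4) (n : ℤ)) (torusLift (2 * S + 1) U)) :=
    B.measurable.comp ((configShift _).measurable.comp (measurable_torusLift _))
  have hfb : ∀ U : GaugeConfig 4 (2 * S + 1) G, |A.F (torusLift (2 * S + 1) U)| ≤ MA :=
    fun U => hMA _
  have hgb : ∀ U : GaugeConfig 4 (2 * S + 1) G,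
      |B.F (configShift (-Pi.single (0 : Fin 4) (n : ℤ)) (torusLift (2 * S + 1) U))| ≤ MB :=
    fun U => hMB _
  -- supports and time distances
  have hTf : ∀ ℓ, ℓ ∉ A.supp.image (torusEdge (2 * S + 1)) → ∀ (U : GaugeConfig 4 (2 * S + 1) G)
      (g' : G), A.F (torusLift (2 * S + 1) (Function.update U ℓ g')) = A.F (torusLift (2 * S + 1) U) :=
    fun ℓ hℓ U g' => apply_torusLift_update A hℓ U g'
  have hfar : ∀ ℓ ∈ A.supp.image (torusEdge (2 * S + 1)),
      n - A.supp.sup (fun e => (e.1 0).natAbs) ≤ tdist (n : ZMod (2 * S + 1)) ℓ :=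
    fun ℓ hℓ => sub_le_tdist_of_mem_image A hn hℓ
  -- oscillations of `g`: weight `a = e⁻¹`, amplitude `2 M_B e^{R_B}`
  have ha0 : (0 : ℝ) < Real.exp (-1) := Real.exp_pos _
  have ha1 : Real.exp (-1) ≤ 1 := by rw [Real.exp_le_one_iff]; norm_num
  have hgo : ∀ ℓ : Edge 4 (2 * S + 1), osc (fun U : GaugeConfig 4 (2 * S + 1) G =>
      B.F (configShift (-Pi.single (0 : Fin 4) (n : ℤ)) (torusLift (2 * S + 1) U))) ℓ ≤
      (2 * MB * Real.exp ((B.supp.sup fun e => (e.1 0).natAbs : ℕ) : ℝ)) *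
        Real.exp (-1) ^ tdist (n : ZMod (2 * S + 1)) ℓ := by
    intro ℓ
    refine (osc_configShift_torusLift_le B _ hMB ℓ).trans ?_
    split_ifs with hmem
    · have ht : (tdist (n : ZMod (2 * S + 1)) ℓ : ℝ) ≤ ((B.supp.sup fun e => (e.1 0).natAbs : ℕ) : ℝ) := by
        exact_mod_cast tdist_le_of_mem_image_shift B n hmem
      have h1 : (1 : ℝ) ≤ Real.exp ((B.supp.sup fun e => (e.1 0).natAbs : ℕ) : ℝ) *
          Real.exp (-1) ^ tdist (n : ZMod (2 * S + 1)) ℓ := by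
        rw [← Real.exp_nat_mul, ← Real.exp_add]
        exact Real.one_le_exp (by linarith)
      calc MB + MB = 2 * MB * 1 := by ring
        _ ≤ 2 * MB * (Real.exp ((B.supp.sup fun e => (e.1 0).natAbs : ℕ) : ℝ) *
            Real.exp (-1) ^ tdist (n : ZMod (2 * S + 1)) ℓ) :=
            mul_le_mul_of_nonneg_left h1 (by positivity)
        _ = _ := by ring
    · positivity
  -- the one-torus bound with Glauber time `k = n / 1200`
  have key := abs_cov_le (d := 4) (L := 2 * S + 1) r.ρ β r.continuous hC'1 hP hfm hgm hfb hgb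
    (A.supp.image (torusEdge (2 * S + 1))) hTf (n : ZMod (2 * S + 1))
    (n - A.supp.sup fun e => (e.1 0).natAbs) hfar ha0 ha1 (by positivity) hgo (n / 1200)
  have hcard : ((A.supp.image (torusEdge (2 * S + 1))).card : ℝ) ≤ A.supp.card := by
    exact_mod_cast Finset.card_image_le
  have hT1 := gapTerm_le hC'1 n
  have hT2 := coneTerm_le hC'1 n (A.supp.sup fun e => (e.1 0).natAbs)
  have hE : 0 ≤ Real.exp (-(1 / (4 * max C 1 * 1200) * n)) := (Real.exp_pos _).le
  -- translation invariance of the torus Wilson state: `⟨B ∘ τ⟩ = ⟨B⟩`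
  have hmean : ∫ U, B.F (configShift (-Pi.single (0 : Fin 4) (n : ℤ)) (torusLift (2 * S + 1) U))
      ∂(wilsonMeasure (d := 4) (L := 2 * S + 1) r.ρ β) =
      ∫ U, B.F (torusLift (2 * S + 1) U) ∂(wilsonMeasure (d := 4) (L := 2 * S + 1) r.ρ β) := by
    have h := wilsonExpectation_comp_torusConfigShift (d := 4) (L := 2 * S + 1) r.ρ β
      (Literature.Probability.LatticeModels.Torus.proj (2 * S + 1) (-Pi.single (0 : Fin 4) (n : ℤ)))
      (toTorusObservable (2 * S + 1) B.F)
    rw [← toTorusObservable_comp_configShift] at h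
    exact h
  unfold latticeConnectedCorr
  rw [← hmean]
  refine key.trans ?_
  calc 2 * MA * MB * Real.exp (-(((n / 1200 : ℕ) : ℝ) / (4 * max C 1))) +
        ((n / 1200 : ℕ) : ℝ) * ((A.supp.image (torusEdge (2 * S + 1))).card : ℝ) * MA *
          (2 * MB * Real.exp ((B.supp.sup fun e => (e.1 0).natAbs : ℕ) : ℝ) *
            Real.exp (2 * ((4 + 1) * (4 + 4 * 4) : ℕ) / Real.exp (-1) * ((n / 1200 : ℕ) : ℝ))) *
          Real.exp (-1) ^ (n - A.supp.sup fun e => (e.1 0).natAbs)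
      = 2 * MA * MB * Real.exp (-(((n / 1200 : ℕ) : ℝ) / (4 * max C 1))) +
        2 * ((A.supp.image (torusEdge (2 * S + 1))).card : ℝ) * MA * MB *
          Real.exp ((B.supp.sup fun e => (e.1 0).natAbs : ℕ) : ℝ) *
          (((n / 1200 : ℕ) : ℝ) * (Real.exp (2 * ((4 + 1) * (4 + 4 * 4) : ℕ) / Real.exp (-1) *
            ((n / 1200 : ℕ) : ℝ)) * Real.exp (-1) ^ (n - A.supp.sup fun e => (e.1 0).natAbs))) := by
          ring
    _ ≤ 2 * MA * MB * (2 * Real.exp (-(1 / (4 * max C 1 * 1200) * n))) +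
        2 * (A.supp.card : ℝ) * MA * MB * Real.exp ((B.supp.sup fun e => (e.1 0).natAbs : ℕ) : ℝ) *
          (4 * Real.exp ((A.supp.sup fun e => (e.1 0).natAbs : ℕ) : ℝ) *
            Real.exp (-(1 / (4 * max C 1 * 1200) * n))) := by
          gcongr
    _ = (4 * MA * MB + 8 * A.supp.card * MA * MB *
          Real.exp (((A.supp.sup fun e => (e.1 0).natAbs : ℕ) : ℝ) + ((B.supp.sup fun e => (e.1 0).natAbs : ℕ) : ℝ))) *
        Real.exp (-(1 / (4 * max C 1 * 1200) * n)) := by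
          rw [Real.exp_add]
          ring
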